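import Literature.Probability.LatticeModels.AnnealedDeviceCorrLabelled
import Literature.Analysis.FunctionSpaces.ChordalNearestPoisson
import Literature.Analysis.FunctionSpaces.PointConfigFactorialMeasure
import Literature.Analysis.FunctionSpaces.PoissonDistinctValues
import HarnessLib

/-!
# The quenched device Gibbs average is a.e.-strongly measurable under Poisson laws

Topic `Probability/LatticeModels`; second half of the construction fact "NOT here" of
`AnnealedDeviceCorr.lean` (first half: `AnnealedDeviceCorrLabelled.lean`), i.e. stub D2
`stub_deviceMeasurable` of line `birth` of the crux `DeviceWeylUniversality` of route
`CriticalPhenomena/Ising3DConformalLimit/ConformalPoissonDevice` (stmt-CriticalPhenomena-4722):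

* `tuplesEquivEmbedding`, `equivOfTuple` — the `k`-tuples of distinct points of length `#ω` of a finite
  configuration (`PointConfig.tuples`, the index set of the factorial measure) are its bijective
  labellings; `labelledGibbsAverage_tuple` — on each of them the labelled Gibbs average IS
  `deviceGibbsAverage β n x ω` (unique read-outs);
* `deviceSumA`, `deviceSumB`, `deviceGibbsAverageM` — the COUNT-MEASURABLE version
  `D(ω) = (∑_{q ∈ tuples k(ω) ω} (G q + 1)) / #(tuples k(ω) ω) − 1`, `k(ω) = N_ω(univ)`, measurable by
  the Campbell/factorial measurability `PointConfig.measurable_tsum_tuples` (Last–Penrose 2017,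
  Prop. 4.3) and the Borel measurability of the labelled average; `deviceGibbsAverageM_eq` — it agrees
  with `deviceGibbsAverage` on finite configurations with unique read-outs;
* `aestronglyMeasurable_deviceGibbsAverage`, `integrable_deviceGibbsAverage` — under a Poisson law
  whose finite intensity has a density (a.s. finite configuration, Kingman 1993 §2.1; a.s. unique
  chordal-nearest sites, Mecke's equation, Last–Penrose 2017 Thm 4.1) the quenched device Gibbs average
  is a.e.-strongly measurable and integrable: `annealedDeviceCorr` is a genuine expectation.
-/

noncomputable section

open scoped Classical
open MeasureTheory Set Function
open Literature.Analysis.FunctionSpaces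

namespace Literature.Probability.LatticeModels


/-! ### Sums over labelled tuples of a configuration -/

section Tuples

variable {d : ℕ}

local notation "𝔼" => EuclideanSpace ℝ (Fin d)

open PointConfig (tuples)
open scoped ENNReal

/-- On `Fin 0` the labelled Gibbs average is `1` (empty read-outs, probability measure). [folklore] -/
theorem labelledGibbsAverage_fin_zero (β : ℝ) (n : ℕ) (x : Fin n → 𝔼) (p : Fin 0 → 𝔼) :
    labelledGibbsAverage β n x p = 1 := by
  letI := locallyFiniteOfFin (labelledPencilGraph p)
  have hobs : labelledObservable p n x = fun _ => 1 := by
    funext σ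
    unfold labelledObservable
    refine Finset.prod_eq_one fun i _ => ?_
    rw [show labelledReadout p (x i) = ∅ from Finset.eq_empty_of_isEmpty _, Finset.prod_empty]
  rw [labelledGibbsAverage_eq, hobs, isingExpect]
  simp

/-- The tuples of distinct points of length `#ω` of a finite configuration are its bijective labellings:
they correspond to the embeddings `Fin k ↪ ↥h.toFinset`. [folklore] -/
def tuplesEquivEmbedding {ω : PointConfig 𝔼} (h : (ω : Set 𝔼).Finite) (k : ℕ) :
    ↥(tuples k ω) ≃ (Fin k ↪ ↥h.toFinset) where
  toFun q := ⟨fun i => ⟨(q : Fin k → 𝔼) i, h.mem_toFinset.2 (q.2.2 i)⟩,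
    fun _ _ hij => q.2.1 (congrArg Subtype.val hij)⟩
  invFun f := ⟨fun i => (f i : 𝔼), fun _ _ hij => f.injective (Subtype.ext hij),
    fun i => h.mem_toFinset.1 (f i).2⟩
  left_inv _ := rfl
  right_inv _ := rfl

/-- A tuple of distinct points of length `#ω` of a finite configuration, as a bijective labelling
`Fin k ≃ ↥h.toFinset`. [folklore] -/
def equivOfTuple {ω : PointConfig 𝔼} (h : (ω : Set 𝔼).Finite) {k : ℕ} (hk : h.toFinset.card = k)
    (q : ↥(tuples k ω)) : Fin k ≃ ↥h.toFinset :=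
  Equiv.ofBijective (tuplesEquivEmbedding h k q)
    ((Fintype.bijective_iff_injective_and_card _).2
      ⟨(tuplesEquivEmbedding h k q).injective, by rw [Fintype.card_fin, Fintype.card_coe, hk]⟩)

/-- The labelling `equivOfTuple` has the tuple's points as values. [folklore] -/
@[simp] theorem coe_equivOfTuple_apply {ω : PointConfig 𝔼} (h : (ω : Set 𝔼).Finite) {k : ℕ}
    (hk : h.toFinset.card = k) (q : ↥(tuples k ω)) (a : Fin k) :
    ((equivOfTuple h hk q a : ↥h.toFinset) : 𝔼) = (q : Fin k → 𝔼) a :=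
  rfl

/-- **On the bijective labellings the labelled Gibbs average is the device Gibbs average**: for a
finite configuration with `k` points and unique chordal read-outs, every `q ∈ tuples k ω` gives
`labelledGibbsAverage β n x q = deviceGibbsAverage β n x ω`. [cite: FriedliVelenik2017, §3.1, Def. 3.1] -/
theorem labelledGibbsAverage_tuple {ω : PointConfig 𝔼} (h : (ω : Set 𝔼).Finite) {k : ℕ}
    (hk : h.toFinset.card = k) (β : ℝ) (n : ℕ) (x : Fin n → 𝔼)
    (hsub : ∀ i, {q | IsChordalNearest (ω : Set 𝔼) (x i) q}.Subsingleton) (q : ↥(tuples k ω)) :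
    labelledGibbsAverage β n x (q : Fin k → 𝔼) = deviceGibbsAverage β n x ω := by
  rcases (ω : Set 𝔼).eq_empty_or_nonempty with hω | hne
  · -- the empty configuration: `k = 0`, both sides are `1`
    have hk0 : k = 0 := by
      rw [← hk, Finset.card_eq_zero, Set.Finite.toFinset_eq_empty]
      exact hω
    subst hk0
    rw [labelledGibbsAverage_fin_zero, deviceGibbsAverage_of_eq_empty β n x hω]
  · have := labelledGibbsAverage_eq_deviceGibbsAverage h hne (equivOfTuple h hk q) β n x hsub
    exact this

/-- The shifted labelled sum `A_k(ω) = ∑_{q ∈ tuples k ω} (G(q) + 1)` (`G` = labelled Gibbs average,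
shifted to be non-negative), an `ℝ≥0∞`-valued functional of the configuration. [folklore] -/
def deviceSumA (β : ℝ) (n : ℕ) (x : Fin n → 𝔼) (k : ℕ) (ω : PointConfig 𝔼) : ℝ≥0∞ :=
  ∑' q : ↥(tuples k ω), ENNReal.ofReal (labelledGibbsAverage β n x (q : Fin k → 𝔼) + 1)

/-- The number of tuples `B_k(ω) = #(tuples k ω)` as an `ℝ≥0∞`-valued sum. [folklore] -/
def deviceSumB (k : ℕ) (ω : PointConfig 𝔼) : ℝ≥0∞ :=
  ∑' _q : ↥(tuples k ω), (1 : ℝ≥0∞)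

/-- `ω ↦ A_k(ω)` is measurable for the count σ-algebra (Campbell/factorial measurability,
`PointConfig.measurable_tsum_tuples`, with the Borel measurability of the labelled Gibbs average).
[cite: LastPenrose2017, Prop. 4.3] -/
theorem measurable_deviceSumA (β : ℝ) (n : ℕ) (x : Fin n → 𝔼) (k : ℕ) :
    Measurable (deviceSumA β n x k) :=
  PointConfig.measurable_tsum_tuples
    ((ENNReal.measurable_ofReal.comp ((measurable_labelledGibbsAverage β n x).add_const 1)).comp
      measurable_snd)

/-- `ω ↦ B_k(ω)` is measurable. [cite: LastPenrose2017, Prop. 4.3] -/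
theorem measurable_deviceSumB (k : ℕ) : Measurable (deviceSumB (d := d) k) :=
  PointConfig.measurable_tsum_tuples measurable_const

/-- **The measurable version of the device Gibbs average**:
`D(ω) = (A_{k(ω)}(ω) / B_{k(ω)}(ω)).toReal − 1` with `k(ω) = N_ω(univ)` (junk `0` used by `toNat`
on infinite configurations). [folklore] -/
def deviceGibbsAverageM (β : ℝ) (n : ℕ) (x : Fin n → 𝔼) (ω : PointConfig 𝔼) : ℝ :=
  (deviceSumA β n x (ω.count Set.univ).toNat ω / deviceSumB (ω.count Set.univ).toNat ω).toReal - 1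

/-- `deviceGibbsAverageM β n x` is measurable for the count σ-algebra. [cite: LastPenrose2017, Prop. 4.3] -/
theorem measurable_deviceGibbsAverageM (β : ℝ) (n : ℕ) (x : Fin n → 𝔼) :
    Measurable (deviceGibbsAverageM β n x) := by
  have hk : Measurable fun ω : PointConfig 𝔼 => (ω.count Set.univ).toNat :=
    (measurable_of_countable ENat.toNat).comp (PointConfig.measurable_count MeasurableSet.univ)
  have hA : Measurable fun r : PointConfig 𝔼 × ℕ => deviceSumA β n x r.2 r.1 :=
    measurable_from_prod_countable_left fun k => measurable_deviceSumA β n x k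
  have hB : Measurable fun r : PointConfig 𝔼 × ℕ => deviceSumB r.2 r.1 :=
    measurable_from_prod_countable_left fun k => measurable_deviceSumB k
  have hpair : Measurable fun ω : PointConfig 𝔼 => (ω, (ω.count Set.univ).toNat) :=
    measurable_id.prodMk hk
  unfold deviceGibbsAverageM
  exact (((hA.comp hpair).div (hB.comp hpair)).ennreal_toReal).sub_const 1

/-- **The measurable version agrees with the device Gibbs average on the good configurations**: for a
finite configuration with unique chordal read-outs of every marked point,
`deviceGibbsAverageM β n x ω = deviceGibbsAverage β n x ω` (every bijective labelling contributes the
same value; there are `k! ∈ [1, ∞)` of them). [folklore] -/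
theorem deviceGibbsAverageM_eq {ω : PointConfig 𝔼} (h : (ω : Set 𝔼).Finite) (β : ℝ) (n : ℕ)
    (x : Fin n → 𝔼) (hsub : ∀ i, {q | IsChordalNearest (ω : Set 𝔼) (x i) q}.Subsingleton) :
    deviceGibbsAverageM β n x ω = deviceGibbsAverage β n x ω := by
  set k := h.toFinset.card with hk
  have hcount : (ω.count Set.univ).toNat = k := by
    rw [PointConfig.count, Set.inter_univ]
    change (ω : Set 𝔼).encard.toNat = k
    rw [Set.Finite.encard_eq_coe_toFinset_card h, ENat.toNat_coe]
  -- the tuples of length `k` are the `k!` bijective labellings: a finite non-empty index set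
  haveI : Fintype ↥(tuples k ω) := Fintype.ofEquiv _ (tuplesEquivEmbedding h k).symm
  haveI : Nonempty ↥(tuples k ω) :=
    ⟨(tuplesEquivEmbedding h k).symm (h.toFinset.equivFinOfCardEq hk.symm).symm.toEmbedding⟩
  have hval : ∀ q : ↥(tuples k ω),
      labelledGibbsAverage β n x (q : Fin k → 𝔼) = deviceGibbsAverage β n x ω :=
    labelledGibbsAverage_tuple h hk.symm β n x hsub
  set c : ℝ≥0∞ := ENNReal.ofReal (deviceGibbsAverage β n x ω + 1) with hc
  have hA : deviceSumA β n x k ω = (Fintype.card ↥(tuples k ω) : ℝ≥0∞) * c := by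
    unfold deviceSumA
    rw [tsum_fintype]
    simp_rw [hval]
    rw [Finset.sum_const, Finset.card_univ, nsmul_eq_mul]
  have hB : deviceSumB k ω = (Fintype.card ↥(tuples k ω) : ℝ≥0∞) := by
    unfold deviceSumB
    rw [tsum_fintype, Finset.sum_const, Finset.card_univ, nsmul_eq_mul, mul_one]
  have hcard : (Fintype.card ↥(tuples k ω) : ℝ≥0∞) ≠ 0 := by exact_mod_cast Fintype.card_ne_zero
  have hcard' : (Fintype.card ↥(tuples k ω) : ℝ≥0∞) ≠ ⊤ := ENNReal.natCast_ne_top _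
  have hnonneg : 0 ≤ deviceGibbsAverage β n x ω + 1 := by
    have := abs_le.1 (abs_deviceGibbsAverage_le_one β n x ω)
    linarith [this.1]
  unfold deviceGibbsAverageM
  rw [hcount, hA, hB, mul_comm, mul_div_assoc, ENNReal.div_self hcard hcard', mul_one, hc,
    ENNReal.toReal_ofReal hnonneg, add_sub_cancel_right]

end Tuples

/-! ### Almost-sure measurability under Poisson laws -/

section AlmostEverywhere

variable {d : ℕ}

local notation "𝔼" => EuclideanSpace ℝ (Fin d)

/-- **The quenched device Gibbs average is a.e.-strongly measurable under a Poisson law with a finite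
intensity having a density** (the construction fact "NOT here" of `AnnealedDeviceCorr.lean`): it agrees
a.e. with the count-measurable functional `deviceGibbsAverageM` — the configuration is a.s. finite
(`IsPoissonPointProcess.ae_finite`, Kingman 1993 §2.1) and the chordal-nearest site of each marked
point is a.s. unique (`ae_subsingleton_isChordalNearest`, Mecke's equation, Last–Penrose 2017 Thm 4.1).
Hence `annealedDeviceCorr P β n x` is a genuine expectation, not a Bochner junk value.
[cite: LastPenrose2017, Thm 4.1] -/
theorem aestronglyMeasurable_deviceGibbsAverage [Nontrivial 𝔼] {ν : Measure 𝔼} [IsFiniteMeasure ν]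
    (hν : ν ≪ (volume : Measure 𝔼)) {P : Measure (PointConfig 𝔼)} (hP : IsPoissonPointProcess ν P)
    (β : ℝ) (n : ℕ) (x : Fin n → 𝔼) :
    AEStronglyMeasurable (deviceGibbsAverage β n x) P := by
  refine (measurable_deviceGibbsAverageM β n x).aestronglyMeasurable.congr ?_
  filter_upwards [hP.ae_finite (measure_ne_top ν Set.univ),
    ae_all_iff.2 fun i => hP.ae_subsingleton_isChordalNearest hν (x i)] with ω hfin hsub
  exact deviceGibbsAverageM_eq hfin β n x hsub

/-- Consequently the annealed device correlator is the genuine integral of an INTEGRABLE function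
(bounded by `1`, a.e.-strongly measurable, finite law). [folklore] -/
theorem integrable_deviceGibbsAverage [Nontrivial 𝔼] {ν : Measure 𝔼} [IsFiniteMeasure ν]
    (hν : ν ≪ (volume : Measure 𝔼)) {P : Measure (PointConfig 𝔼)} (hP : IsPoissonPointProcess ν P)
    (β : ℝ) (n : ℕ) (x : Fin n → 𝔼) :
    Integrable (deviceGibbsAverage β n x) P := by
  haveI := hP.isProbabilityMeasure
  refine Integrable.of_bound (aestronglyMeasurable_deviceGibbsAverage hν hP β n x) 1 ?_
  exact Filter.Eventually.of_forall fun ω => by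
    rw [Real.norm_eq_abs]
    exact abs_deviceGibbsAverage_le_one β n x ω

end AlmostEverywhere


end Literature.Probability.LatticeModels

end
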